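import Summits.CriticalPhenomena.PercolationContinuityZ3.Theorems.Transplant.FKConnectivityAllQEdgeMono
import HarnessLib

/-!
# Connectivity correlation inequalities for `φ_{w,q}`, every `q > 0` — RIGID INTERPOLATION: an identity that is affine in every pair
# parameter holds for all weight vectors as soon as it holds for the rigid ones (parameters in `{0,1}`)

Support file (`--supports stmt-CriticalPhenomena-4575`), FK sub-lane `prim-bschramm-fk-3` (gen 8) of the post-continuity programme; builds on
p205010 (kernel theorem, internal audit signed; external expert review pending).  No definitions, no named facts, no sorries; standard axioms.

Masses `S_w(E) = Σ_ω w_q(ω) 1_E(ω)` and the partition function `Z_w` of the edge-parameter random-cluster measure (Grimmett 2006 (1.20)) are AFFINE in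
each single parameter `w e` (`sum_rcWeightW_ind_affine`, `rcPartitionFunctionW_affine`, fk-2), and at a RIGID weight vector (every parameter `0` or `1`)
they are carried by the single configuration `{e | w e = 1}` (`sum_rcWeightW_ind_rigid`).  Hence any candidate closed form `T(w)` for a mass — e.g. the
cyclic 2×2 transfer formula `Z_G = q[Tr ∏ E(r_i)S(p_i) − (2−q)∏ r_i ∏(1−p_v)]` of LEMMA T (bschramm/prim-bschramm-fk-3/WHEELS-HUB-NC.md §2), which is affine in
each parameter as well — is proved for ALL parameter values once it is checked on the finitely many rigid ones, where both sides are a single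
configuration's `q^{k(ω)}` (a DECIDABLE check for a fixed finite shape, `FK.RCEval`, fk-3 g5).  This file proves that principle:
* **`FK.eq_zero_of_affine_of_rigid`** — if `L(w) = (1 − w e)·L(w[e↦0]) + (w e)·L(w[e↦1])` for every `e ∈ D` and every `w` vanishing off `D`, and
  `L(w) = 0` for every rigid `w` vanishing off `D`, then `L(w) = 0` for every `w` vanishing off `D` (induction on the number of non-rigid pairs);
* `FK.eq_of_affine_of_rigid` — the two-function form `T₁ = T₂`;
* `FK.rcWeightW_rigid_self`, `FK.sum_rcWeightW_ind_rigid_eq_pow` — at a rigid `w`, `S_w(E) = q^{k(ω_w)}·1_E(ω_w)` with `ω_w = {e | w e = 1}`, and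
  `FK.rcPartitionFunctionW_rigid_eq_pow` — `Z_w = q^{k(ω_w)}`.
[cite: Grimmett2006, §1.4 eq. (1.20) (p. 15); Thm. (3.1)(a) (p. 37)]
-/

noncomputable section

namespace Summit.CriticalPhenomena.PercolationContinuityZ3.Theorems

namespace FK

open MeasureTheory Literature.Probability.LatticeModels Literature.Probability.Percolation
open Literature.Probability.Percolation.BHK2006 (weight)
open Literature.Probability.Percolation.DecisionTree (ind ind_of_mem ind_of_not_mem ind_nonneg)
open scoped Classical

variable {V : Type*} [Fintype V]

omit [Fintype V] in
/-- Updating a pair inside `D` keeps a weight vector vanishing off `D`. [folklore] -/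
theorem update_vanishes_off {D : Finset (Sym2 V)} {w : Sym2 V → unitInterval} (hw : ∀ e, e ∉ D → w e = 0) {e : Sym2 V}
    (he : e ∈ D) (c : unitInterval) : ∀ g, g ∉ D → Function.update w e c g = 0 := by
  intro g hg
  have hge : g ≠ e := fun h => hg (by rw [h]; exact he)
  rw [Function.update_of_ne hge]
  exact hw g hg

omit [Fintype V] in
/-- After pinning `e` to `0` or `1`, the non-rigid pairs of `D` are among the previous ones minus `e`. [folklore] -/
theorem nonrigid_filter_update_subset (D : Finset (Sym2 V)) (w : Sym2 V → unitInterval) (e : Sym2 V) (c : unitInterval)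
    (hc : ((c : unitInterval) : ℝ) = 0 ∨ ((c : unitInterval) : ℝ) = 1) :
    (D.filter fun g => ¬ (((Function.update w e c g : unitInterval) : ℝ) = 0 ∨ ((Function.update w e c g : unitInterval) : ℝ) = 1)) ⊆
      (D.filter fun g => ¬ (((w g : unitInterval) : ℝ) = 0 ∨ ((w g : unitInterval) : ℝ) = 1)).erase e := by
  intro g hg
  rw [Finset.mem_filter] at hg
  rw [Finset.mem_erase, Finset.mem_filter]
  by_cases hge : g = e
  · subst hge
    rw [Function.update_self] at hg
    exact absurd hc hg.2
  · rw [Function.update_of_ne hge] at hg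
    exact ⟨hge, hg⟩

/-- **Rigid interpolation**: let `L` be a real function of the weight vector which is affine in every pair parameter of `D`
(`L(w) = (1 − w e)·L(w[e↦0]) + (w e)·L(w[e↦1])` for `w` vanishing off `D`, `e ∈ D`) and vanishes at every RIGID weight vector vanishing off `D`
(all parameters in `{0,1}`); then `L` vanishes at every weight vector vanishing off `D`.  (Induction on the number of non-rigid pairs.)
[cite: Grimmett2006, §1.4 eq. (1.20) (p. 15); Thm. (3.1)(a) (p. 37)] -/
theorem eq_zero_of_affine_of_rigid (D : Finset (Sym2 V)) (L : (Sym2 V → unitInterval) → ℝ)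
    (haff : ∀ w : Sym2 V → unitInterval, (∀ e, e ∉ D → w e = 0) → ∀ e ∈ D,
      L w = (1 - ((w e : unitInterval) : ℝ)) * L (Function.update w e 0) + ((w e : unitInterval) : ℝ) * L (Function.update w e 1))
    (hrig : ∀ w : Sym2 V → unitInterval, (∀ e, e ∉ D → w e = 0) →
      (∀ e ∈ D, ((w e : unitInterval) : ℝ) = 0 ∨ ((w e : unitInterval) : ℝ) = 1) → L w = 0)
    (w : Sym2 V → unitInterval) (hw : ∀ e, e ∉ D → w e = 0) : L w = 0 := by
  -- induction on the number of non-rigid pairs in `D`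
  suffices h : ∀ (k : ℕ) (w : Sym2 V → unitInterval), (∀ e, e ∉ D → w e = 0) →
      (D.filter fun g => ¬ (((w g : unitInterval) : ℝ) = 0 ∨ ((w g : unitInterval) : ℝ) = 1)).card ≤ k → L w = 0 from
    h _ w hw le_rfl
  intro k
  induction k with
  | zero =>
    intro w hw hk
    apply hrig w hw
    intro e he
    by_contra hne
    have hmem : e ∈ D.filter fun g => ¬ (((w g : unitInterval) : ℝ) = 0 ∨ ((w g : unitInterval) : ℝ) = 1) :=
      Finset.mem_filter.2 ⟨he, hne⟩
    rw [Nat.le_zero, Finset.card_eq_zero] at hk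
    rw [hk] at hmem
    exact absurd hmem (Finset.notMem_empty e)
  | succ k ih =>
    intro w hw hk
    by_cases hall : ∀ e ∈ D, ((w e : unitInterval) : ℝ) = 0 ∨ ((w e : unitInterval) : ℝ) = 1
    · exact hrig w hw hall
    · simp only [not_forall] at hall
      obtain ⟨e, heD, hne⟩ := hall
      have hmem : e ∈ D.filter fun g => ¬ (((w g : unitInterval) : ℝ) = 0 ∨ ((w g : unitInterval) : ℝ) = 1) :=
        Finset.mem_filter.2 ⟨heD, hne⟩
      have hcard : ∀ c : unitInterval, (((c : unitInterval) : ℝ) = 0 ∨ ((c : unitInterval) : ℝ) = 1) →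
          (D.filter fun g => ¬ (((Function.update w e c g : unitInterval) : ℝ) = 0 ∨
            ((Function.update w e c g : unitInterval) : ℝ) = 1)).card ≤ k := by
        intro c hc
        have hsub := nonrigid_filter_update_subset D w e c hc
        have h1 := Finset.card_le_card hsub
        rw [Finset.card_erase_of_mem hmem] at h1
        omega
      have h0 : L (Function.update w e 0) = 0 :=
        ih _ (update_vanishes_off hw heD 0) (hcard 0 (Or.inl rfl))
      have h1 : L (Function.update w e 1) = 0 :=
        ih _ (update_vanishes_off hw heD 1) (hcard 1 (Or.inr rfl))
      rw [haff w hw e heD, h0, h1, mul_zero, mul_zero, add_zero]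

/-- **Rigid interpolation, two-function form**: two real functions of the weight vector, each affine in every pair parameter of `D`, that agree on
the rigid weight vectors vanishing off `D` agree on every weight vector vanishing off `D`. [cite: Grimmett2006, §1.4 eq. (1.20) (p. 15); Thm. (3.1)(a) (p. 37)] -/
theorem eq_of_affine_of_rigid (D : Finset (Sym2 V)) (T₁ T₂ : (Sym2 V → unitInterval) → ℝ)
    (h₁ : ∀ w : Sym2 V → unitInterval, (∀ e, e ∉ D → w e = 0) → ∀ e ∈ D,
      T₁ w = (1 - ((w e : unitInterval) : ℝ)) * T₁ (Function.update w e 0) + ((w e : unitInterval) : ℝ) * T₁ (Function.update w e 1))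
    (h₂ : ∀ w : Sym2 V → unitInterval, (∀ e, e ∉ D → w e = 0) → ∀ e ∈ D,
      T₂ w = (1 - ((w e : unitInterval) : ℝ)) * T₂ (Function.update w e 0) + ((w e : unitInterval) : ℝ) * T₂ (Function.update w e 1))
    (hrig : ∀ w : Sym2 V → unitInterval, (∀ e, e ∉ D → w e = 0) →
      (∀ e ∈ D, ((w e : unitInterval) : ℝ) = 0 ∨ ((w e : unitInterval) : ℝ) = 1) → T₁ w = T₂ w)
    (w : Sym2 V → unitInterval) (hw : ∀ e, e ∉ D → w e = 0) : T₁ w = T₂ w := by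
  have h := eq_zero_of_affine_of_rigid D (fun v => T₁ v - T₂ v)
    (fun v hv e he => by rw [h₁ v hv e he, h₂ v hv e he]; ring)
    (fun v hv hr => sub_eq_zero.2 (hrig v hv hr)) w hw
  exact sub_eq_zero.1 h

/-! ### The rigid evaluations -/

/-- At a rigid weight vector the configuration `ω_w = {e | w e = 1}` has product weight `1`, so `w_q(ω_w) = q^{k(ω_w)}`.
[cite: Grimmett2006, §1.4 eq. (1.20) (p. 15)] -/
theorem rcWeightW_rigid_self (w : Sym2 V → unitInterval) (q : ℝ) (B : Set V)
    (hR : ∀ e : Sym2 V, ((w e : unitInterval) : ℝ) = 0 ∨ ((w e : unitInterval) : ℝ) = 1) :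
    rcWeightW w q B {e | ((w e : unitInterval) : ℝ) = 1} = q ^ clusterCount {e | ((w e : unitInterval) : ℝ) = 1} B := by
  unfold rcWeightW weight
  beta_reduce
  convert one_mul (q ^ clusterCount {e | ((w e : unitInterval) : ℝ) = 1} B) using 2
  refine Finset.prod_eq_one fun e _ => ?_
  split_ifs with he
  · exact he
  · rcases hR e with h0 | h1'
    · rw [h0, sub_zero]
    · exact absurd h1' he

/-- **Masses at a rigid weight vector**: `S_w(E) = q^{k(ω_w)}·1_E(ω_w)`. [cite: Grimmett2006, §1.4 eq. (1.20) (p. 15)] -/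
theorem sum_rcWeightW_ind_rigid_eq_pow (w : Sym2 V → unitInterval) (q : ℝ)
    (hR : ∀ e : Sym2 V, ((w e : unitInterval) : ℝ) = 0 ∨ ((w e : unitInterval) : ℝ) = 1) (E : Set (BondConfig V)) :
    ∑ ω : BondConfig V, rcWeightW w q ∅ ω * ind E ω =
      q ^ clusterCount {e | ((w e : unitInterval) : ℝ) = 1} (∅ : Set V) * ind E {e | ((w e : unitInterval) : ℝ) = 1} := by
  rw [sum_rcWeightW_ind_rigid w q hR E, rcWeightW_rigid_self w q ∅ hR]

/-- **Partition function at a rigid weight vector**: `Z_w = q^{k(ω_w)}`. [cite: Grimmett2006, §1.4 eq. (1.20) (p. 15)] -/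
theorem rcPartitionFunctionW_rigid_eq_pow (w : Sym2 V → unitInterval) (q : ℝ)
    (hR : ∀ e : Sym2 V, ((w e : unitInterval) : ℝ) = 0 ∨ ((w e : unitInterval) : ℝ) = 1) :
    rcPartitionFunctionW w q ∅ = q ^ clusterCount {e | ((w e : unitInterval) : ℝ) = 1} (∅ : Set V) := by
  have h := sum_rcWeightW_ind_rigid_eq_pow w q hR Set.univ
  rw [ind_of_mem (Set.mem_univ _), mul_one] at h
  unfold rcPartitionFunctionW
  rw [← h]
  exact Finset.sum_congr rfl fun ω _ => by rw [ind_of_mem (Set.mem_univ ω), mul_one]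

end FK

end Summit.CriticalPhenomena.PercolationContinuityZ3.Theorems

end
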